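import Mathlib.CategoryTheory.Preadditive.Biproducts
import Mathlib.CategoryTheory.Idempotents.Basic
import Mathlib.CategoryTheory.Linear.Basic
import Literature.RingTheory.SimpleModule.ArtinianLocalRingIdempotents
import HarnessLib

/-!
# Indecomposable objects, idempotent endomorphisms and local endomorphism rings in preadditive categories
# (Krause, *Krull–Schmidt categories and projective covers*, Prop. 5.4; Shah, *Krull–Remak–Schmidt decompositions in
# Hom-finite additive categories*, Lemma 3.5, Prop. 3.11, Lemma 4.5, Thm. 6.1)

Family `hodge`, lane `lit-hodgefound` (foundations library; seat `lit-hodgefound-p39`, generation 36, row g36-#13); topic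
`CategoryTheory/Preadditive`, namespace `Literature.CategoryTheory.KrullSchmidt`.  First categorical step «towards Krull–Schmidt for
motives»: the dictionary between direct-sum decompositions `X ≅ Y ⊞ Z` of an object of a preadditive category with binary biproducts and
idempotents of the ring `End X`, and the characterisation of indecomposable objects by LOCAL endomorphism rings in idempotent-complete
(Karoubian) categories whose endomorphism rings are artinian — e.g. `Hom`-finite `k`-linear categories (motives with finite-dimensional
algebras of correspondences).  Mathlib supplies `CategoryTheory.Indecomposable X` («`X` is not zero and `X ≅ Y ⊞ Z` forces `Y = 0` or
`Z = 0`»), `IsIdempotentComplete`, the ring `End X` and `Linear k C`; the ring-theoretic input «an artinian ring with only the trivial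
idempotents is local» is g36-#5 `ArtinianLocalRingIdempotents.isLocalRing_of_forall_isIdempotentElem` (Lam (19.19)).

Sources, verbatim.  Shah [Shah2023KRS]: **Lemma 3.5.** «If `Λ` is local, then `Λ` has precisely two idempotents `0` and `1`.» (with «The
converse of the following lemma holds if `Λ` is artinian; see e.g. [Lam]»); **Definition 3.8.** «A category `𝒜` has split idempotents if,
for each `X ∈ 𝒜` and every idempotent `e ∈ End_𝒜(X)`, there exists an object `Y ∈ 𝒜` and morphisms `r : X → Y`, `s : Y → X` such that
`e = sr` and `rs = 1_Y`.»  **Proposition 3.11.** «If an additive category `𝒜` has split idempotents, then for each idempotent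
`e : X → X` we have `X = Ker(e) ⊕ Ker(1_X − e)`.»  **Definition 4.3.** «An object `X ∈ 𝒜` is called indecomposable if `X` is non-zero,
and if `X₁ = 0` or `X₂ = 0` whenever there is an isomorphism `X ≅ X₁ ⊕ X₂`.»  **Lemma 4.5.** «If `End_𝒜(X)` is local, then `X` is
indecomposable.  Proof. … Let `pⱼ : X ↠ Xⱼ`, respectively, `iⱼ : Xⱼ ↪ X`, be the canonical projection, respectively, inclusion for
`j = 1, 2`. Then `eⱼ ≔ iⱼpⱼ ∈ End_𝒜(X)` is idempotent and so we must have `eⱼ` is `0` or `1_X` … If `e₁ = 0 = e₂`, then we would have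
`1_X = e₁ + e₂ = 0`, which is a contradiction. Hence, without loss of generality, `e₁ ≠ 0` and so `e₁ = 1_X`. Moreover, this yields
`e₂ = 0` and hence `X₂ = 0`, so `X` is indecomposable.»  **Theorem 6.1.** «Let `𝒜` be a `Hom`-finite `k`-linear category. Then the
following are equivalent. (1) `𝒜` is a Krull-Schmidt category. (2) `𝒜` has split idempotents. (3) For any object `Y ∈ 𝒜`, the ring
`End_𝒜(Y)` is local if and only if `Y` is indecomposable.»  Krause [Krause2015KS, Prop. 5.4]: «An object satisfying the bi-chain
condition is indecomposable if and only if its endomorphism ring is local. … If `X = X₁ ⊕ X₂` with `Xᵢ ≠ 0` for `i = 1, 2`, then we have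
idempotent endomorphisms `εᵢ` of `X` with `Im εᵢ = Xᵢ`. Clearly, each `εᵢ` is non-invertible but `id_X = ε₁ + ε₂`.»

## What is formalised (`C` preadditive with binary biproducts)

* §1 the idempotents of a decomposition `i : X ≅ Y ⊞ Z`: `e_Y = i ∘ … ` (`i.hom ≫ biprod.fst ≫ biprod.inl ≫ i.inv`) and `e_Z` are
  idempotent endomorphisms with `e_Y + e_Z = 𝟙` and `e_Y = 0 ⟺ Y` is zero (`comp_self_fstIdem`, `fstIdem_add_sndIdem`,
  `isZero_iff_fstIdem_eq_zero`, …).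
* §2 **Shah Lemma 4.5 ∕ Krause 5.4 (⟸)**: an object whose only idempotent endomorphisms are `0`, `𝟙` (and which is not zero) is
  indecomposable (`indecomposable_of_forall_idempotent`); **`indecomposable_of_isLocalRing_end`**.
* §3 **Shah Prop. 3.11 with Def. 3.8 (idempotent-complete categories)**: an idempotent `p` gives `X ≅ Y ⊞ Z` with `e_Y = p`
  (`exists_iso_biprod_of_idempotent`), hence the idempotent endomorphisms of an indecomposable object are `0` and `𝟙`
  (`idempotent_eq_zero_or_id_of_indecomposable`, ring form `isIdempotentElem_end_iff`).
* §4 **Shah Thm. 6.1 (2) ⟹ (3), object-wise**: in an idempotent-complete preadditive category, an object with ARTINIAN endomorphism ring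
  is indecomposable iff `End X` is local (`indecomposable_iff_isLocalRing_end`); corollaries for `k`-linear categories with `End X`
  finite-dimensional over a field (`…_of_finite`) or of finite length over a commutative artinian ring.

Theorems only, 0 `sorry`, no definition, no named fact (net debt 0, D-0026), no instance, no notation.

## Mathlib / Literature search

Mathlib: `CategoryTheory.Indecomposable` (`Limits/Shapes/BinaryBiproducts`), `IsIdempotentComplete.idempotents_split`, `End X` with
`End.mul_def : f * g = g ≫ f`, `Preadditive` ring structure on `End X`, `Linear.instModuleEnd`/`instAlgebraEnd`, `biprod.lift_desc`,
`biprod.total`, `Limits.IsZero.iff_id_eq_zero`, `IsArtinianRing.of_finite`, `isArtinian_of_tower`; Mathlib has no Krull–Schmidt category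
notion and no «indecomposable ⟺ local End».  Literature: g36-#5 `isLocalRing_of_forall_isIdempotentElem`,
`forall_isIdempotentElem_of_isLocalRing`; nothing under `Literature/CategoryTheory` before this file.

## References

* A. Shah, *Krull–Remak–Schmidt decompositions in Hom-finite additive categories*, Expo. Math. 41 (2023), 220–237, arXiv:2209.00337:
  Lemma 3.5, Def. 3.8, Prop. 3.11, Def. 4.3, Lemma 4.5, Thm. 6.1. [Shah2023KRS]
* H. Krause, *Krull–Schmidt categories and projective covers*, Expo. Math. 33 (2015), 535–549, arXiv:1410.2822: §4 (Krull–Schmidt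
  categories), Prop. 5.4. [Krause2015KS]
* T. Y. Lam, *A First Course in Noncommutative Rings*, 2nd ed., GTM 131, Springer (2001), §19 (19.19). [Lam2001FirstCourse]
-/

open CategoryTheory CategoryTheory.Limits

namespace Literature.CategoryTheory.KrullSchmidt

universe v u

variable {C : Type u} [Category.{v} C] [Preadditive C] [HasBinaryBiproducts C]

/-! ## §1 The idempotents `e_Y`, `e_Z` of a decomposition `X ≅ Y ⊞ Z` -/

section Decomposition

variable {X Y Z : C} (i : X ≅ Y ⊞ Z)

/-- `e_Y = (X ≅ Y ⊞ Z → Y → Y ⊞ Z ≅ X)` is an idempotent endomorphism («`eⱼ ≔ iⱼpⱼ` is idempotent»). [cite: Shah2023KRS, proof of Lemma 4.5] -/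
theorem comp_self_fstIdem :
    (i.hom ≫ biprod.fst ≫ biprod.inl ≫ i.inv) ≫ (i.hom ≫ biprod.fst ≫ biprod.inl ≫ i.inv) =
      i.hom ≫ biprod.fst ≫ biprod.inl ≫ i.inv := by
  simp only [Category.assoc, Iso.inv_hom_id_assoc, biprod.inl_fst_assoc]

/-- `e_Z` is an idempotent endomorphism. [cite: Shah2023KRS, proof of Lemma 4.5] -/
theorem comp_self_sndIdem :
    (i.hom ≫ biprod.snd ≫ biprod.inr ≫ i.inv) ≫ (i.hom ≫ biprod.snd ≫ biprod.inr ≫ i.inv) =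
      i.hom ≫ biprod.snd ≫ biprod.inr ≫ i.inv := by
  simp only [Category.assoc, Iso.inv_hom_id_assoc, biprod.inr_snd_assoc]

/-- **`e_Y + e_Z = 1_X`** («`1_X = e₁ + e₂`»). [cite: Shah2023KRS, proof of Lemma 4.5] [cite: Krause2015KS, proof of Prop. 5.4] -/
theorem fstIdem_add_sndIdem :
    i.hom ≫ biprod.fst ≫ biprod.inl ≫ i.inv + i.hom ≫ biprod.snd ≫ biprod.inr ≫ i.inv = 𝟙 X := by
  rw [← Category.assoc biprod.fst, ← Category.assoc biprod.snd, ← Preadditive.comp_add, ← Preadditive.add_comp, biprod.total,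
    Category.id_comp, Iso.hom_inv_id]

/-- `e_Y = 0` iff `Y` is a zero object. [cite: Shah2023KRS, proof of Lemma 4.5 («this yields `e₂ = 0` and hence `X₂ = 0`»)] -/
theorem isZero_iff_fstIdem_eq_zero : IsZero Y ↔ i.hom ≫ biprod.fst ≫ biprod.inl ≫ i.inv = 0 := by
  constructor
  · intro hY
    rw [hY.eq_zero_of_tgt biprod.fst, zero_comp, comp_zero]
  · intro h
    refine (IsZero.iff_id_eq_zero Y).2 ?_
    have : biprod.inl ≫ i.inv ≫ (i.hom ≫ biprod.fst ≫ biprod.inl ≫ i.inv) ≫ i.hom ≫ biprod.fst = 𝟙 Y := by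
      simp only [Category.assoc, Iso.inv_hom_id_assoc, biprod.inl_fst, Category.comp_id]
    rw [← this, h, zero_comp, comp_zero, comp_zero]

/-- `e_Z = 0` iff `Z` is a zero object. [cite: Shah2023KRS, proof of Lemma 4.5] -/
theorem isZero_iff_sndIdem_eq_zero : IsZero Z ↔ i.hom ≫ biprod.snd ≫ biprod.inr ≫ i.inv = 0 := by
  constructor
  · intro hZ
    rw [hZ.eq_zero_of_tgt biprod.snd, zero_comp, comp_zero]
  · intro h
    refine (IsZero.iff_id_eq_zero Z).2 ?_
    have : biprod.inr ≫ i.inv ≫ (i.hom ≫ biprod.snd ≫ biprod.inr ≫ i.inv) ≫ i.hom ≫ biprod.snd = 𝟙 Z := by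
      simp only [Category.assoc, Iso.inv_hom_id_assoc, biprod.inr_snd, Category.comp_id]
    rw [← this, h, zero_comp, comp_zero, comp_zero]

end Decomposition

/-! ## §2 Shah Lemma 4.5 ∕ Krause Prop. 5.4 (⟸): local (or idempotent-free) endomorphism ring ⟹ indecomposable -/

section LocalImpliesIndecomposable

variable {X : C}

omit [Preadditive C] [HasBinaryBiproducts C] in
/-- For an endomorphism `p`, being an idempotent of the ring `End X` is `p ≫ p = p` (`End.mul_def`). [cite: Shah2023KRS, Example 3.2] -/
theorem isIdempotentElem_end_iff (p : End X) : IsIdempotentElem p ↔ (p : X ⟶ X) ≫ p = p := Iff.rfl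

/-- **A non-zero object whose only idempotent endomorphisms are `0` and `𝟙` is indecomposable** («`eⱼ` is `0` or `1_X` … `X₂ = 0`»).
[cite: Shah2023KRS, proof of Lemma 4.5] [cite: Krause2015KS, proof of Prop. 5.4] -/
theorem indecomposable_of_forall_idempotent (hX : ¬IsZero X) (h : ∀ p : X ⟶ X, p ≫ p = p → p = 0 ∨ p = 𝟙 X) : Indecomposable X := by
  refine ⟨hX, fun Y Z i => ?_⟩
  rcases h _ (comp_self_fstIdem i) with h0 | h1
  · exact Or.inl ((isZero_iff_fstIdem_eq_zero i).2 h0)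
  · refine Or.inr ((isZero_iff_sndIdem_eq_zero i).2 ?_)
    have hsum := fstIdem_add_sndIdem i
    rwa [h1, add_eq_left] at hsum

/-- The same with the hypothesis on the ring `End X`. [cite: Shah2023KRS, Lemma 4.5, Lemma 3.5] -/
theorem indecomposable_of_forall_isIdempotentElem (hX : ¬IsZero X) (h : ∀ p : End X, IsIdempotentElem p → p = 0 ∨ p = 1) :
    Indecomposable X :=
  indecomposable_of_forall_idempotent hX fun p hp => h p hp

/-- **SHAH LEMMA 4.5 ∕ KRAUSE PROP. 5.4 (⟸): an object with LOCAL endomorphism ring is indecomposable** (a local ring is non-zero and has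
only the idempotents `0`, `1` — Lemma 3.5). [cite: Shah2023KRS, Lemma 4.5, Lemma 3.5] [cite: Krause2015KS, Prop. 5.4] -/
theorem indecomposable_of_isLocalRing_end [IsLocalRing (End X)] : Indecomposable X :=
  indecomposable_of_forall_isIdempotentElem (fun hX => one_ne_zero (α := End X) ((IsZero.iff_id_eq_zero X).1 hX))
    fun p hp => Literature.RingTheory.SimpleModule.forall_isIdempotentElem_of_isLocalRing p hp

end LocalImpliesIndecomposable

/-! ## §3 Shah Prop. 3.11: with split idempotents, an idempotent decomposes the object -/

section SplitIdempotents

variable [IsIdempotentComplete C] {X : C}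

/-- **SHAH PROP. 3.11 («`X = Ker(e) ⊕ Ker(1_X − e)`»), biproduct form.**  In an idempotent-complete preadditive category, an idempotent
`p : X ⟶ X` and its complement `𝟙 − p` split as `X →π Y →ι X`, `X →π' Z →ι' X`, and `(π, π') : X ≅ Y ⊞ Z` with inverse `(ι, ι')`;
under this isomorphism `e_Y = p`. [cite: Shah2023KRS, Prop. 3.11, Def. 3.8] -/
theorem exists_iso_biprod_of_idempotent (p : X ⟶ X) (hp : p ≫ p = p) :
    ∃ (Y Z : C) (i : X ≅ Y ⊞ Z), i.hom ≫ biprod.fst ≫ biprod.inl ≫ i.inv = p := by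
  obtain ⟨Y, ι, π, hιπ, hπι⟩ := IsIdempotentComplete.idempotents_split X p hp
  have hq : (𝟙 X - p) ≫ (𝟙 X - p) = 𝟙 X - p := by
    simp only [Preadditive.sub_comp, Preadditive.comp_sub, Category.id_comp, Category.comp_id, hp, sub_self, sub_zero]
  obtain ⟨Z, ι', π', hιπ', hπι'⟩ := IsIdempotentComplete.idempotents_split X (𝟙 X - p) hq
  -- the cross terms vanish: `ι ≫ π' = 0`, `ι' ≫ π = 0`
  have h1 : ι ≫ p = ι := by rw [← hπι, ← Category.assoc, hιπ, Category.id_comp]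
  have h1' : ι' ≫ (𝟙 X - p) = ι' := by rw [← hπι', ← Category.assoc, hιπ', Category.id_comp]
  have hιπ'0 : ι ≫ π' = 0 := by
    calc ι ≫ π' = ι ≫ (π' ≫ ι') ≫ π' := by rw [Category.assoc, hιπ', Category.comp_id]
      _ = ι ≫ (𝟙 X - p) ≫ π' := by rw [hπι']
      _ = 0 := by rw [Preadditive.sub_comp, Category.id_comp, Preadditive.comp_sub, ← Category.assoc ι p π', h1, sub_self]
  have hι'π0 : ι' ≫ π = 0 := by
    calc ι' ≫ π = ι' ≫ (π ≫ ι) ≫ π := by rw [Category.assoc, hιπ, Category.comp_id]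
      _ = ι' ≫ p ≫ π := by rw [hπι]
      _ = 0 := by
        have h2 : ι' ≫ p = 0 := by
          have := h1'
          rw [Preadditive.comp_sub, Category.comp_id, sub_eq_self] at this
          exact this
        rw [← Category.assoc, h2, zero_comp]
  refine ⟨Y, Z, ⟨biprod.lift π π', biprod.desc ι ι', ?_, ?_⟩, ?_⟩
  · rw [biprod.lift_desc, hπι, hπι', add_sub_cancel]
  · ext <;> simp [hιπ, hιπ', hιπ'0, hι'π0]
  · simp only [biprod.lift_fst_assoc, biprod.inl_desc, hπι]

/-- **With split idempotents, the only idempotent endomorphisms of an indecomposable object are `0` and `𝟙`** (Prop. 3.11 and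
Def. 4.3). [cite: Shah2023KRS, Prop. 3.11, Def. 4.3] -/
theorem idempotent_eq_zero_or_id_of_indecomposable (hX : Indecomposable X) (p : X ⟶ X) (hp : p ≫ p = p) : p = 0 ∨ p = 𝟙 X := by
  obtain ⟨Y, Z, i, hi⟩ := exists_iso_biprod_of_idempotent p hp
  rcases hX.2 Y Z i with hY | hZ
  · left
    rw [← hi]
    exact (isZero_iff_fstIdem_eq_zero i).1 hY
  · right
    have hsum := fstIdem_add_sndIdem i
    rwa [hi, (isZero_iff_sndIdem_eq_zero i).1 hZ, add_zero] at hsum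

/-- Ring form: the idempotents of `End X`, `X` indecomposable, are `0` and `1`. [cite: Shah2023KRS, Prop. 3.11, Def. 4.3] -/
theorem isIdempotentElem_end_eq_zero_or_one_of_indecomposable (hX : Indecomposable X) (p : End X) (hp : IsIdempotentElem p) :
    p = 0 ∨ p = 1 :=
  idempotent_eq_zero_or_id_of_indecomposable hX p hp

end SplitIdempotents

/-! ## §4 Shah Thm. 6.1 (2) ⟹ (3): indecomposable ⟺ local endomorphism ring, for artinian endomorphism rings -/

section Artinian

variable [IsIdempotentComplete C] {X : C}

omit [HasBinaryBiproducts C] [IsIdempotentComplete C] in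
/-- A non-zero object has a non-trivial endomorphism ring. [cite: Shah2023KRS, proof of Lemma 4.5 («`1_X ≠ 0` and hence `X ≠ 0`»)] -/
theorem nontrivial_end_of_not_isZero (hX : ¬IsZero X) : Nontrivial (End X) :=
  ⟨⟨0, 1, fun h => hX ((IsZero.iff_id_eq_zero X).2 h.symm)⟩⟩

/-- **An indecomposable object with ARTINIAN endomorphism ring, in an idempotent-complete preadditive category, has LOCAL endomorphism
ring** (the idempotents of `End X` are trivial by §3, and an artinian ring with trivial idempotents is local, Lam (19.19) — «the converse
of the following lemma holds if `Λ` is artinian»). [cite: Shah2023KRS, Thm. 6.1 (2) ⟹ (3), Lemma 3.5] [cite: Lam2001FirstCourse, §19 (19.19)] -/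
theorem isLocalRing_end_of_indecomposable [IsArtinianRing (End X)] (hX : Indecomposable X) : IsLocalRing (End X) := by
  haveI := nontrivial_end_of_not_isZero hX.1
  exact Literature.RingTheory.SimpleModule.isLocalRing_of_forall_isIdempotentElem
    fun p hp => isIdempotentElem_end_eq_zero_or_one_of_indecomposable hX p hp

/-- **SHAH THM. 6.1 (3), object-wise: in an idempotent-complete preadditive category, an object with artinian endomorphism ring is
indecomposable iff its endomorphism ring is local.** [cite: Shah2023KRS, Thm. 6.1] [cite: Krause2015KS, Prop. 5.4] -/
theorem indecomposable_iff_isLocalRing_end [IsArtinianRing (End X)] : Indecomposable X ↔ IsLocalRing (End X) :=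
  ⟨fun hX => isLocalRing_end_of_indecomposable hX, fun _ => indecomposable_of_isLocalRing_end⟩

/-- **`Hom`-finite `k`-linear categories over a field**: if `End X` is finite-dimensional over a field `k` (so artinian), then `X` is
indecomposable iff `End X` is local. [cite: Shah2023KRS, Thm. 6.1] -/
theorem indecomposable_iff_isLocalRing_end_of_finite (k : Type*) [Field k] [Linear k C] [Module.Finite k (End X)] :
    Indecomposable X ↔ IsLocalRing (End X) :=
  haveI : IsArtinianRing (End X) := IsArtinianRing.of_finite k (End X)
  indecomposable_iff_isLocalRing_end

/-- `Hom`-finite over a commutative ring `k` in Shah's sense («each `Hom`-set is a finite length `k`-module»): if `End X` is an artinian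
`k`-module then it is an artinian ring, and `X` is indecomposable iff `End X` is local. [cite: Shah2023KRS, Thm. 6.1, §5] -/
theorem indecomposable_iff_isLocalRing_end_of_isArtinian (k : Type*) [CommRing k] [Linear k C] [IsArtinian k (End X)] :
    Indecomposable X ↔ IsLocalRing (End X) :=
  haveI : IsArtinianRing (End X) := isArtinian_of_tower k (inferInstance : IsArtinian k (End X))
  indecomposable_iff_isLocalRing_end

end Artinian

end Literature.CategoryTheory.KrullSchmidt
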